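import Summits.ValiantsHypothesis.ValiantsHypothesis.Theorems.DepthWindowBDSSequences
import HarnessLib

/-!
# Route `DepthWindow` — the Bhargav–Dutta–Saxena two-letter spacing law (PLAN-w2, file F2)

Helper file of the route `Theses/DepthWindow.lean` (decomp-valiant workshop, lens 4, generation 10), on top of
`DepthWindowBDSSequences.lean` (the recursions of [BhargavDuttaSaxena2024, §4.1] for `b_m`, `|c_m|`, `P_m` and
`p₀ = |c_0|`, `q₀ = b_{N+1} + b_N`, kept as HYPOTHESES on arbitrary functions `r b A : ℕ → ℕ`; `A i = |c_{N+1-i}|`).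
In the BDS word the positive letter is `(q₀ - p₀)t` and the negative letter `-q₀ t` (`k = q₀ t`); a sub-word with `a`
positive and `D - a` negative letters has imbalance `t·|(2a - D) q₀ - a p₀|`, and the depth induction of
[LimayeSrinivasanTavenas2025, Claim 16] needs this to be LINEAR in `D` for every part below the threshold of its
level — the role played by `k`-unbiasedness (`|w_S| ≥ #S·k/4` for `#S ≤ k/20`) in the LST word.  This file proves
exactly that, with thresholds `θ_{m+1} = b_{m+1}/2`, and packages the parameters:

* `key` — `m ≤ N`, `1 ≤ a`, `2a ≤ b_{m+1}`, any integer `j`: `a|c_m| ≤ b_m |a p₀ - j q₀|`, i.e.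
  `dist(a·p₀/q₀, ℤ) ≥ a|c_m|/(b_m q₀)` ([BhargavDuttaSaxena2024, eq. (4.6)] has `≥ a/(8 q₀ λ^{G(m+2)-1}… )`-type bounds);
* `law` — `a ≤ D`, `2D ≤ b_{m+1}`: `D|c_m| ≤ 2 b_m |(2a - D) q₀ - a p₀|` (imbalance `≥ D · t|c_m|/(2 b_m)`);
* `step` — `λ q₀ b_m ≤ 8 b_{m+2}|c_m|`: with the rate `κ_{m+1} = t|c_m|/(2b_m)` a product of degree `≥ θ_{m+2}` loses
  at least `2^{-θ_{m+2} κ_{m+1}/2} ≤ 2^{-kλ/64}`, uniformly in the level (this is where the Fibonacci design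
  `r_{m+1} + 1 = λ^{F_{m+2}} ≥ λ b_m` enters); `step_zero` — the bottom seam `λ q₀ ≤ 4 b_1 (q₀ - p₀)`;
* `exists_params` — for every `λ ≥ 2` and `N`: thresholds `b`, rates `c`, and `p₀, q₀` with all of the above, plus
  `λ b_m ≤ λ^{F_{m+2}}`, `λ p₀ ≤ q₀ ≤ 2λ p₀`, `q₀ ≤ 2 b_{N+1}` — the only interface the circuit side consumes.

The proofs of `key`/`law` use the Wronskian identity instead of the Ostrowski digits of the source (MFCS 2022, App. A,
Claims 8–10 / Lemma 18): shorter, with constants at least as good.  Definition-free, unconditional, 0 sorry; rung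
currency only — nothing here bears on `VP ≠ VNP` itself.

References: [BhargavDuttaSaxena2024] §4.3 eqs. (4.2)–(4.6) (= MFCS 2022, LIPIcs 241:18, App. A, Claims 8–10, Lemma 18);
[LimayeSrinivasanTavenas2025] Claim 16.
-/

-- layout Summits/ValiantsHypothesis/ValiantsHypothesis forces the duplicated namespace component
set_option linter.dupNamespace false

namespace Summit.ValiantsHypothesis.ValiantsHypothesis.Theorems.DepthWindow.BDS

open Nat

/-! ## The spacing law -/

/-- **Spacing of the multiples of `p₀/q₀`** (the content of [BhargavDuttaSaxena2024, eq. (4.6)] / MFCS 2022 eq. (3)):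
for `m ≤ N`, `1 ≤ a` and `2a ≤ b_{m+1}`, every integer `j` has `a|c_m| ≤ b_m |a p₀ - j q₀|`; in words,
`dist(a·p₀/q₀, ℤ) ≥ a|c_m|/(b_m q₀)` as long as `a` is at most half the next denominator.  Proof: with
`p₀ b_m = P_m q₀ ± |c_m|`, `b_m (a p₀ - j q₀) = q₀ (a P_m - j b_m) ± a|c_m|`; if `a P_m = j b_m` this is `± a|c_m|`,
otherwise its size is at least `q₀ - a|c_m| ≥ q₀/2 ≥ a|c_m|` by the Wronskian bound `b_{m+1}|c_m| ≤ q₀`. -/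
theorem key {lam N m : ℕ} {r b A : ℕ → ℕ} (hb0 : b 0 = 1) (hb1 : b 1 = lam)
    (hb2 : ∀ m, b (m + 2) = r (m + 1) * b (m + 1) + b m)
    (hA0 : A 0 = 1) (hA1 : A 1 = 1) (hA2 : ∀ i, A (i + 2) = r (N - i) * A (i + 1) + A i)
    (hm : m ≤ N) {a : ℕ} (ha : 1 ≤ a) (h2a : 2 * a ≤ b (m + 1)) (j : ℤ) :
    (a : ℤ) * A (N + 1 - m) ≤ b m * |a * A (N + 1) - j * (b (N + 1) + b N : ℕ)| := by
  obtain ⟨P, hP0, hP1, hP2⟩ := exists_rec_seq (fun m => r (m + 1)) 0 1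
  have hc := cong hb0 hb1 hb2 hA0 hA1 hA2 hP0 hP1 hP2 (m := m) (by omega)
  have hq : 2 * (a * A (N + 1 - m)) ≤ b (N + 1) + b N := by
    have h1 := b_succ_mul_A_le hb2 hA0 hA1 hA2 hm
    calc 2 * (a * A (N + 1 - m)) = (2 * a) * A (N + 1 - m) := by ring
      _ ≤ b (m + 1) * A (N + 1 - m) := Nat.mul_le_mul_right _ h2a
      _ ≤ _ := h1
  set Q : ℤ := ((b (N + 1) + b N : ℕ) : ℤ) with hQ
  have hq' : 2 * ((a : ℤ) * A (N + 1 - m)) ≤ Q := by rw [hQ]; exact_mod_cast hq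
  set Av : ℤ := ((A (N + 1 - m) : ℕ) : ℤ) with hAv
  set X : ℤ := (a : ℤ) * A (N + 1) - j * Q with hX
  set Z : ℤ := (a : ℤ) * P m - j * b m with hZ
  have hid : (b m : ℤ) * X = Q * Z + a * ((-1) ^ m * Av) := by
    simp only [hX, hZ]
    linear_combination (a : ℤ) * hc
  have ha0 : (0 : ℤ) ≤ a := by positivity
  have hAv0 : (0 : ℤ) ≤ Av := by positivity
  have hσ : |((-1 : ℤ) ^ m * Av)| = Av := by
    rw [abs_mul, abs_pow, abs_neg, abs_one, one_pow, one_mul, abs_of_nonneg hAv0]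
  have hbX : (b m : ℤ) * |X| = |Q * Z + a * ((-1) ^ m * Av)| := by
    rw [← hid, abs_mul, abs_of_nonneg (by positivity : (0 : ℤ) ≤ b m)]
  rw [hbX]
  by_cases hZ0 : Z = 0
  · rw [hZ0, mul_zero, zero_add, abs_mul, hσ, abs_of_nonneg ha0]
  · have hσ' := abs_le.1 hσ.le
    have hlo : -((a : ℤ) * Av) ≤ a * ((-1) ^ m * Av) := by nlinarith [hσ'.1]
    have hhi : (a : ℤ) * ((-1) ^ m * Av) ≤ a * Av := by nlinarith [hσ'.2]
    have hq0 : (0 : ℤ) ≤ Q := by positivity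
    rcases lt_or_gt_of_ne hZ0 with hneg | hpos
    · have hZ1 : Z + 1 ≤ 0 := Int.add_one_le_iff.2 hneg
      have hqZ : Q * Z ≤ -Q := by
        have h := mul_le_mul_of_nonneg_left (show Z ≤ -1 by linarith) hq0
        linarith
      calc (a : ℤ) * Av ≤ Q - a * Av := by linarith
        _ ≤ -(Q * Z + a * ((-1) ^ m * Av)) := by linarith
        _ ≤ _ := neg_le_abs _
    · have hZ1 : 0 + 1 ≤ Z := Int.add_one_le_iff.2 hpos
      have hqZ : Q ≤ Q * Z := by
        have h := mul_le_mul_of_nonneg_left (show (1 : ℤ) ≤ Z by linarith) hq0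
        linarith
      calc (a : ℤ) * Av ≤ Q - a * Av := by linarith
        _ ≤ Q * Z + a * ((-1) ^ m * Av) := by linarith
        _ ≤ _ := le_abs_self _

/-- **The two-letter law** (used by the depth induction exactly where LST use `k`-unbiasedness; [BhargavDuttaSaxena2024,
§4.3, the bound on `relrk(Q_{i,j})`]): a sub-word with `a` positive letters `(q₀ - p₀)t` and `D - a` negative letters
`-q₀ t`, `a ≤ D`, `2D ≤ b_{m+1}` (`m ≤ N`), has imbalance `t |(2a - D) q₀ - a p₀| ≥ D · t|c_m|/(2 b_m)`:
`D|c_m| ≤ 2 b_m |(2a - D) q₀ - a p₀|`.  (If `2a ≤ D` the negative letters win outright: the imbalance is at least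
`(D - a) p₀ ≥ D p₀/2`; otherwise `key` applies with `j = 2a - D`.) -/
theorem law {lam N m : ℕ} {r b A : ℕ → ℕ} (hlam : 1 ≤ lam) (hr : ∀ m, 1 ≤ r m) (hb0 : b 0 = 1)
    (hb1 : b 1 = lam) (hb2 : ∀ m, b (m + 2) = r (m + 1) * b (m + 1) + b m)
    (hA0 : A 0 = 1) (hA1 : A 1 = 1) (hA2 : ∀ i, A (i + 2) = r (N - i) * A (i + 1) + A i)
    (hm : m ≤ N) {a D : ℕ} (haD : a ≤ D) (h2D : 2 * D ≤ b (m + 1)) :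
    (D : ℤ) * A (N + 1 - m) ≤
      2 * b m * |((2 * a : ℤ) - D) * (b (N + 1) + b N : ℕ) - a * A (N + 1)| := by
  have hbm : (1 : ℤ) ≤ b m := by
    have h : b 0 ≤ b m := b_mono hlam hr hb0 hb1 hb2 (Nat.zero_le m)
    rw [hb0] at h
    exact_mod_cast h
  have hAp : (A (N + 1 - m) : ℤ) ≤ A (N + 1) := by
    exact_mod_cast A_mono hr hA0 hA1 hA2 (show N + 1 - m ≤ N + 1 by omega)
  have hpq : (A (N + 1) : ℤ) ≤ (b (N + 1) + b N : ℕ) := by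
    rw [q_eq hb0 hb1 hb2 hA0 hA1 hA2]
    push_cast
    nlinarith [(by exact_mod_cast hlam : (1 : ℤ) ≤ lam), (by positivity : (0 : ℤ) ≤ A (N + 1)),
      (by positivity : (0 : ℤ) ≤ A N)]
  have hA0' : (0 : ℤ) ≤ A (N + 1 - m) := by positivity
  have hp0 : (0 : ℤ) ≤ A (N + 1) := by positivity
  have ha0 : (0 : ℤ) ≤ a := by positivity
  have haD' : (a : ℤ) ≤ D := by exact_mod_cast haD
  set Q : ℤ := ((b (N + 1) + b N : ℕ) : ℤ) with hQ
  by_cases h : 2 * a ≤ D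
  · have h' : 2 * (a : ℤ) ≤ D := by exact_mod_cast h
    have hv : ((2 * a : ℤ) - D) * Q - a * A (N + 1) ≤ 0 := by nlinarith
    rw [abs_of_nonpos hv]
    -- `-(v) = (D - 2a) q₀ + a p₀ ≥ (D - 2a) p₀ + a p₀ = (D - a) p₀ ≥ (D/2) |c_m|`
    have h1 : ((D : ℤ) - 2 * a) * A (N + 1) ≤ ((D : ℤ) - 2 * a) * Q :=
      mul_le_mul_of_nonneg_left hpq (by linarith)
    have h2 : ((D : ℤ) - a) * A (N + 1 - m) ≤ ((D : ℤ) - a) * A (N + 1) :=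
      mul_le_mul_of_nonneg_left hAp (by linarith)
    nlinarith
  · push Not at h
    have ha : 1 ≤ a := by omega
    have hk := key hb0 hb1 hb2 hA0 hA1 hA2 hm ha (by omega) ((2 * a : ℤ) - D)
    rw [abs_sub_comm] at hk
    have hD2a : (D : ℤ) ≤ 2 * a := by exact_mod_cast h.le
    have habs : (0 : ℤ) ≤ |((2 * a : ℤ) - D) * Q - a * A (N + 1)| := abs_nonneg _
    nlinarith

/-- **The level-to-level step**: `λ q₀ b_m ≤ 8 b_{m+2}|c_m|` (`m ≤ N`, `λ ≥ 2`).  With thresholds `θ_p = b_p/2` and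
the rate `κ_{m+1} = t|c_m|/(2 b_m)` given by `law`, a product of degree `≥ θ_{m+2}` at level `m + 2` loses at least
`2^{-θ_{m+2} κ_{m+1}/2} ≤ 2^{-λ q₀ t/64} = 2^{-kλ/64}`, uniformly in the level; this is where the Fibonacci design
`r_{m+1} + 1 = λ^{F_{m+2}} ≥ λ b_m` enters ([BhargavDuttaSaxena2024, §4.3, choice of `κ`]). -/
theorem step {lam N m : ℕ} {r b A : ℕ → ℕ} (hlam : 2 ≤ lam) (hr : ∀ m, 1 ≤ r m)
    (hrE : ∀ m, r m + 1 = lam ^ fib (m + 1)) (hb0 : b 0 = 1) (hb1 : b 1 = lam)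
    (hb2 : ∀ m, b (m + 2) = r (m + 1) * b (m + 1) + b m)
    (hA0 : A 0 = 1) (hA1 : A 1 = 1) (hA2 : ∀ i, A (i + 2) = r (N - i) * A (i + 1) + A i) (hm : m ≤ N) :
    lam * (b (N + 1) + b N) * b m ≤ 8 * b (m + 2) * A (N + 1 - m) := by
  have hq := q_le_two_mul (by omega) hr hb0 hb1 hb2 hA0 hA1 hA2 hm
  have hr1 : r (m + 1) + 1 = lam ^ fib (m + 2) := hrE (m + 1)
  have hbm : lam * b m ≤ lam ^ fib (m + 2) := lam_mul_b_le_pow (by omega) hr hrE hb0 hb1 hb2 m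
  have hpow : lam ≤ lam ^ fib (m + 2) := by
    calc lam = lam ^ 1 := (pow_one lam).symm
      _ ≤ lam ^ fib (m + 2) := Nat.pow_le_pow_right (by omega) (Nat.fib_pos.2 (by omega))
  have h4 : lam * b m ≤ 4 * r (m + 1) := by
    obtain ⟨L, hL⟩ : ∃ L, L = lam ^ fib (m + 2) := ⟨_, rfl⟩
    rw [← hL] at hr1 hbm hpow
    omega
  calc lam * (b (N + 1) + b N) * b m
      ≤ lam * (2 * (b (m + 1) * A (N + 1 - m))) * b m :=
        Nat.mul_le_mul_right _ (Nat.mul_le_mul_left _ hq)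
    _ = 2 * (lam * b m) * (b (m + 1) * A (N + 1 - m)) := by ring
    _ ≤ 2 * (4 * r (m + 1)) * (b (m + 1) * A (N + 1 - m)) :=
        Nat.mul_le_mul_right _ (Nat.mul_le_mul_left _ h4)
    _ = 8 * (r (m + 1) * b (m + 1)) * A (N + 1 - m) := by ring
    _ ≤ 8 * b (m + 2) * A (N + 1 - m) := by
        refine Nat.mul_le_mul_right _ (Nat.mul_le_mul_left _ ?_)
        rw [hb2]
        exact Nat.le_add_right _ _

/-- The bottom seam of the induction (level `1`, threshold `θ_1 = b_1/2 = λ/2`, singleton parts of weight at least the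
positive letter `(q₀ - p₀)t ≥ q₀ t/2`): `λ q₀ ≤ 4 · b_1 · (q₀ - p₀)`, so `2^{-(b_1/2)(q₀ - p₀)t/2} ≤ 2^{-λ q₀ t/16}`. -/
theorem step_zero {lam N : ℕ} {r b A : ℕ → ℕ} (hlam : 2 ≤ lam) (hb0 : b 0 = 1) (hb1 : b 1 = lam)
    (hb2 : ∀ m, b (m + 2) = r (m + 1) * b (m + 1) + b m)
    (hA0 : A 0 = 1) (hA1 : A 1 = 1) (hA2 : ∀ i, A (i + 2) = r (N - i) * A (i + 1) + A i) :
    lam * (b (N + 1) + b N) ≤ 4 * b 1 * (b (N + 1) + b N - A (N + 1)) := by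
  have hq := q_eq hb0 hb1 hb2 hA0 hA1 hA2
  rw [hb1]
  have h2 : 2 * A (N + 1) ≤ b (N + 1) + b N := by
    rw [hq]; nlinarith [Nat.zero_le (A N)]
  have : b (N + 1) + b N ≤ 2 * (b (N + 1) + b N - A (N + 1)) := by omega
  calc lam * (b (N + 1) + b N) ≤ lam * (2 * (b (N + 1) + b N - A (N + 1))) := Nat.mul_le_mul_left _ this
    _ = 2 * lam * (b (N + 1) + b N - A (N + 1)) := by ring
    _ ≤ 4 * lam * (b (N + 1) + b N - A (N + 1)) := Nat.mul_le_mul_right _ (by omega)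

/-! ## The packaged parameters -/

/-- **The BDS word parameters** ([BhargavDuttaSaxena2024, §4.1 and Lemma 4.3], in the form the depth induction
consumes).  For every `λ ≥ 2` and every `N` (the word will serve product-depth `Δ = N + 2`) there are `p₀, q₀`,
thresholds `b : ℕ → ℕ` (`θ_m = b_m/2`) and rates `c : ℕ → ℕ` (`c m = |c_m|`, `κ_{m+1} = t c_m/(2 b_m)`) with:
`b_0 = 1`, `b_1 = λ`, `b` monotone, `λ b_m ≤ λ^{F_{m+2}}` (so `b_Δ ≤ λ^{G(Δ)}`); `1 ≤ p₀`, `λ p₀ ≤ q₀ ≤ 2λ p₀`,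
`q₀ ≤ 2 b_{N+1}`; `1 ≤ c_m ≤ p₀` (`m ≤ N + 1`); the two-letter law `D c_m ≤ 2 b_m |(2a - D) q₀ - a p₀|` for
`a ≤ D`, `2D ≤ b_{m+1}`, `m ≤ N`; the step inequality `λ q₀ b_m ≤ 8 b_{m+2} c_m` (`m ≤ N`); and the bottom seam
`λ q₀ ≤ 4 b_1 (q₀ - p₀)`. -/
theorem exists_params (lam N : ℕ) (hlam : 2 ≤ lam) :
    ∃ (p q : ℕ) (b c : ℕ → ℕ),
      b 0 = 1 ∧ b 1 = lam ∧ Monotone b ∧ (∀ m, lam * b m ≤ lam ^ fib (m + 2)) ∧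
      1 ≤ p ∧ lam * p ≤ q ∧ q ≤ 2 * lam * p ∧ q ≤ 2 * b (N + 1) ∧
      (∀ m, m ≤ N + 1 → 1 ≤ c m ∧ c m ≤ p) ∧
      (∀ m, m ≤ N → ∀ a D : ℕ, a ≤ D → 2 * D ≤ b (m + 1) →
        (D : ℤ) * c m ≤ 2 * b m * |((2 * a : ℤ) - D) * q - a * p|) ∧
      (∀ m, m ≤ N → lam * q * b m ≤ 8 * b (m + 2) * c m) ∧
      lam * q ≤ 4 * b 1 * (q - p) := by
  -- the partial quotients `r_m = λ^{F_{m+1}} - 1`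
  obtain ⟨r, hrE, hr⟩ : ∃ r : ℕ → ℕ, (∀ m, r m + 1 = lam ^ fib (m + 1)) ∧ ∀ m, 1 ≤ r m := by
    refine ⟨fun m => lam ^ fib (m + 1) - 1, fun m => Nat.sub_add_cancel (Nat.one_le_pow _ _ (by omega)),
      fun m => ?_⟩
    have h : lam ≤ lam ^ fib (m + 1) := by
      calc lam = lam ^ 1 := (pow_one lam).symm
        _ ≤ lam ^ fib (m + 1) := Nat.pow_le_pow_right (by omega) (Nat.fib_pos.2 (by omega))
    show 1 ≤ lam ^ fib (m + 1) - 1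
    omega
  obtain ⟨b, hb0, hb1, hb2⟩ := exists_rec_seq (fun m => r (m + 1)) 1 lam
  obtain ⟨A, hA0, hA1, hA2⟩ := exists_rec_seq (fun i => r (N - i)) 1 1
  have hb2' : ∀ m, b (m + 2) = r (m + 1) * b (m + 1) + b m := hb2
  have hA2' : ∀ i, A (i + 2) = r (N - i) * A (i + 1) + A i := hA2
  have hlam1 : 1 ≤ lam := by omega
  have hbmono : Monotone b := b_mono hlam1 hr hb0 hb1 hb2'
  have hAmono : Monotone A := A_mono hr hA0 hA1 hA2'
  have hq := q_eq hb0 hb1 hb2' hA0 hA1 hA2'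
  have hp1 : 1 ≤ A (N + 1) := by
    have h : A 0 ≤ A (N + 1) := hAmono (Nat.zero_le (N + 1)); rw [hA0] at h; exact h
  refine ⟨A (N + 1), b (N + 1) + b N, b, fun m => A (N + 1 - m), hb0, hb1, hbmono,
    lam_mul_b_le_pow hlam1 hr hrE hb0 hb1 hb2', hp1, ?_, ?_, ?_, ?_, ?_, ?_, ?_⟩
  · rw [hq]; exact Nat.le_add_right _ _
  · rw [hq]
    have h : A N ≤ A (N + 1) := hAmono (Nat.le_succ N)
    nlinarith
  · have h : b N ≤ b (N + 1) := hbmono (Nat.le_succ N)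
    omega
  · intro m hm
    refine ⟨?_, hAmono (show N + 1 - m ≤ N + 1 by omega)⟩
    have h : A 0 ≤ A (N + 1 - m) := hAmono (Nat.zero_le (N + 1 - m)); rw [hA0] at h; exact h
  · intro m hm a D haD h2D
    have h := law hlam1 hr hb0 hb1 hb2' hA0 hA1 hA2' hm haD h2D
    exact_mod_cast h
  · intro m hm
    exact step hlam hr hrE hb0 hb1 hb2' hA0 hA1 hA2' hm
  · exact step_zero hlam hb0 hb1 hb2' hA0 hA1 hA2'

end Summit.ValiantsHypothesis.ValiantsHypothesis.Theorems.DepthWindow.BDS
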